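import Mathlib
import Summits.ValiantsHypothesis.ValiantsHypothesis.Theorems.TwoProducts.Negative.RankTwoPadding
import Summits.ValiantsHypothesis.ValiantsHypothesis.Theorems.TwoProducts.Negative.RankTwoPaddingMergeKit

/-!
# val-idea-34 (WAVE-3 lens (c) matroid / rank-one datum rigidity) — Sketch for crux idea `factor-gauge-rigidity`
Crux `stmt-ValiantsHypothesis-5906` (`TwoProducts`), live residue `stub_residual : ResidualLawV20`.
Signatures only (first lemmas of the idea card) + two kernel-checked toy facts.  Nothing here closes an item;
`TwoProducts`, `PlanarCellBound`, VP ≠ VNP are NOT proved.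
-/

namespace Summit.ValiantsHypothesis.ValiantsHypothesis.Cruxes.TwoProducts.ValIdea34

open Finset MvPolynomial
open Summit.ValiantsHypothesis.ValiantsHypothesis.Theorems.NewtonUnitEquations.TwoProducts.FormalLogLinearisation
open Summit.ValiantsHypothesis.ValiantsHypothesis.Theorems.NewtonUnitEquations.TwoProducts.PlanarCell
open Summit.ValiantsHypothesis.ValiantsHypothesis.Theorems.NewtonUnitEquations.TwoProducts.PermutationType
  (msetT PermType RankOneCoincidences)

/-- The hypothesis-free per-cell law (`t ≥ 2`), verbatim the conclusion shape of
`RankTwoPadding.cellLaw_of_noDatumCellLaw`. -/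
def CellLaw : Prop :=
  ∃ a b : ℕ, ∀ (m t : ℕ), 2 ≤ t → ∀ (u v : Fin m → MvPolynomial (Fin 2) ℂ),
    (∀ j, coeff 0 (u j) = 0 ∧ (u j).support.card ≤ t) → (∀ j, coeff 0 (v j) = 0 ∧ (v j).support.card ≤ t) →
    ∀ (R : Expo → Expo → Prop) (S : Finset Expo), IsCellFamily u v R S → S.card ≤ 2 ^ (a * m) * (t + 2) ^ b

/-- HYP1 of `ResidualLawV12/V20` (R5 threshold hatch): no lattice-small block merges to permutation type. -/
def NoSmallPermMerge {m : ℕ} (t : ℕ) (u v : Fin m → MvPolynomial (Fin 2) ℂ) : Prop :=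
  ∀ (J : Finset (Fin m)) (j₀ : Fin m), j₀ ∈ J →
    BlockSmall (fun j => (u j).support ∪ (v j).support) J (2 ^ m * (t + 2) ^ 4) →
    ¬ PermType (mergeA (fun j => (u j).support ∪ (v j).support) J j₀)

/-- HYP2 of `ResidualLawV12/V20` (R1_r threshold hatch), with `ClassCover` of `Lines/relation_ladder.lean` l.2582 inlined:
every cover of the coincidences by `r` relation classes is expensive. -/
def NoCheapClassCover {m : ℕ} (t : ℕ) (u v : Fin m → MvPolynomial (Fin 2) ℂ) : Prop :=
  ∀ (r : ℕ) (Jc : Fin r → Finset (Fin m)) (ac bc : Fin r → Fin m → Expo),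
    (∀ a ∈ tuples (fun j => (u j).support ∪ (v j).support), ∀ b ∈ tuples (fun j => (u j).support ∪ (v j).support),
      a ≠ b → ∑ j, a j = ∑ j, b j →
      ∃ k : Fin r, (∀ j, a j ≠ b j ↔ j ∈ Jc k) ∧
        ((∀ j ∈ Jc k, a j = ac k j ∧ b j = bc k j) ∨ (∀ j ∈ Jc k, a j = bc k j ∧ b j = ac k j))) →
    2 ^ m * (t + 2) ^ 4 < 2 * (m + 1) * (3 * (2 + m + m.choose 2) ^ 2) ^ r

/-- The per-cell law demanded ONLY of instances satisfying both threshold hatches and admitting no rank-one datum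
(= the v21 residual's instance class; the seven v20 shape hatches are instances of `¬∃ datum`). -/
def ResidualInstanceCellLaw : Prop :=
  ∃ a b : ℕ, ∀ (m t : ℕ), 2 ≤ t → ∀ (u v : Fin m → MvPolynomial (Fin 2) ℂ),
    (∀ j, coeff 0 (u j) = 0 ∧ (u j).support.card ≤ t) → (∀ j, coeff 0 (v j) = 0 ∧ (v j).support.card ≤ t) →
    NoSmallPermMerge t u v → NoCheapClassCover t u v →
    (∀ ρp ρm : Expo →₀ ℕ, ¬ RankOneCoincidences (fun j => (u j).support ∪ (v j).support) ρp ρm) →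
    ∀ (R : Expo → Expo → Prop) (S : Finset Expo), IsCellFamily u v R S → S.card ≤ 2 ^ (a * m) * (t + 2) ^ b

/-- **FIRST LEMMA (K1, the card's load-bearing claim): the threshold hatches are gauge-inert too.**
`ResidualInstanceCellLaw → CellLaw` (expected exponents `(a, b) ↦ (51 a, b + 26 a)`), by common deep padding with
`k = 4m + 13⌈log₂(t+2)⌉ + 8` disjoint binomial gadget PAIRS `X^{2N_i s}+X^{4N_i s}` (both positions of pair `i`, both sides),
`N_i = (m+1)·9^i`, `s = Σ tailSupport`: `GadgetsForceBlock` + `GadgetBlockCount` make HYP1 vacuous, the `2^k − 1` distinct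
disagreement sets make HYP2 vacuous, `RankTwoEscape.no_rankOne_datum_of_two_coincidences` kills every datum, and
`CommonPadding.isCellFamily_append_common` keeps every cell family. -/
def GaugeInertThresholds : Prop := ResidualInstanceCellLaw → CellLaw

/-- Engine piece 1 (generalises `RankTwoPaddingMergeKit.not_permType_mergeA_of_gadget_outside` to many pairs):
a block whose merge is of permutation type swallows every gadget pair. -/
def GadgetsForceBlock : Prop :=
  ∀ (n k : ℕ) (M : Fin n → Finset Expo) (J : Finset (Fin n)) (j₀ : Fin n) (p q : Fin k → Fin n) (x : Fin k → Expo),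
    (∀ j, (0 : Expo) ∉ M j) → j₀ ∈ J → Function.Injective (Sum.elim p q) → (∀ i, x i ≠ 0) →
    (∀ i, (2 : ℕ) • x i ∈ M (p i) ∧ (4 : ℕ) • x i ∈ M (p i) ∧ (2 : ℕ) • x i ∈ M (q i) ∧ (4 : ℕ) • x i ∈ M (q i)) →
    PermType (mergeA M J j₀) → ∀ i, p i ∈ J ∧ q i ∈ J

/-- Engine piece 2: once all `k` gadget pairs sit inside the block, the block sumset has at least `5^k` points
(digits `{0,2,4,6,8}·x_i` with unique expansions), so `BlockSmall _ J (2^{n}(t+2)^4)` fails as soon as `(5/4)^k > 2^{n-2k}(t+2)^4`. -/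
def GadgetBlockCount : Prop :=
  ∀ (n k : ℕ) (M : Fin n → Finset Expo) (J : Finset (Fin n)) (p q : Fin k → Fin n) (x : Fin k → Expo),
    Function.Injective (Sum.elim p q) → (∀ i, p i ∈ J ∧ q i ∈ J) →
    (∀ i, (2 : ℕ) • x i ∈ M (p i) ∧ (4 : ℕ) • x i ∈ M (p i) ∧ (2 : ℕ) • x i ∈ M (q i) ∧ (4 : ℕ) • x i ∈ M (q i)) →
    (∀ c c' : Fin k → ℕ, (∀ i, c i ≤ 8) → (∀ i, c' i ≤ 8) → ∑ i, c i • x i = ∑ i, c' i • x i → c = c') →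
    5 ^ k ≤ (blockSet M J).card

/-- Engine piece 3 (the SHALLOW gauge move; defeats the normalisations «delete equal factor pairs» and «delete letters below
every supporting line»): a REGROUPING gadget — the two groupings `{pq, rs}` / `{pr, qs}` of the four binomials
`p = 1+X^α, q = 1+X^β, r = 1+X^{2α}, s = 1+X^{2β}` into 3-sparse-tail factors have the same product (so appending `(pq−1, rs−1)` to `u`
and `(pr−1, qs−1)` to `v` leaves `logDiff` unchanged), while the padded letter family (position alphabets `{α,β,α+β,2α,3α}`,
`{2α,2β,2α+2β,β,3β}`) realises the genuine coincidences `(3α ∣ 0) ~ (α ∣ 2α)` and `(0 ∣ 2β) ~ (β ∣ β)` with NON-proportional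
excess pairs — rank ≥ 2, no datum (`DatumExcess.no_datum_of_two_patterns` / `RankOneCoverage.exists_datum_iff_proportional`). -/
theorem regroup_prod_eq (α β : Expo) :
    ((1 + monomial α (1 : ℂ)) * (1 + monomial β 1)) * ((1 + monomial (2 • α) 1) * (1 + monomial (2 • β) 1)) =
    ((1 + monomial α (1 : ℂ)) * (1 + monomial (2 • α) 1)) * ((1 + monomial β 1) * (1 + monomial (2 • β) 1)) := by
  ring

/-- The regrouping gadget as a two-position padding `u' = (pq − 1, rs − 1)`, `v' = (pr − 1, qs − 1)`: the exact cancellation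
`∏_j (1 + u'_j) = ∏_j (1 + v'_j)` (so `logDiff (Fin.append u u') (Fin.append v v') = logDiff u v` by the proof pattern of
`CommonPadding.logDiff_append_common`), kernel-checked. -/
theorem regroup_padding_prod (α β : Expo) :
    (∏ j : Fin 2, (1 + ![(1 + monomial α (1 : ℂ)) * (1 + monomial β 1) - 1,
                        (1 + monomial (2 • α) (1 : ℂ)) * (1 + monomial (2 • β) 1) - 1] j)) =
    (∏ j : Fin 2, (1 + ![(1 + monomial α (1 : ℂ)) * (1 + monomial (2 • α) 1) - 1,
                        (1 + monomial β (1 : ℂ)) * (1 + monomial (2 • β) 1) - 1] j)) := by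
  simp only [Fin.prod_univ_two, Matrix.cons_val_zero, Matrix.cons_val_one, add_sub_cancel]
  ring

open Classical in
/-- HONEST (gauge-robust) residual axis proposed by the card: the CAP of a cell family — tuple-sumset points strictly above
the supporting line of some visible point — is monotone INCREASING under every `S`-preserving padding and costs `≥ 1`
position per `t` planted points, so «cap ≥ 2^m (t+2)^4» cannot be manufactured at `O(m + log t)` positions.  Typed here as
the threshold sub-law the card names as the honest far residual (`C∞`). -/
def HugeCapCellLaw : Prop :=
  ∃ a b : ℕ, ∀ (m t : ℕ), 2 ≤ t → ∀ (u v : Fin m → MvPolynomial (Fin 2) ℂ),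
    (∀ j, coeff 0 (u j) = 0 ∧ (u j).support.card ≤ t) → (∀ j, coeff 0 (v j) = 0 ∧ (v j).support.card ≤ t) →
    ∀ (R : Expo → Expo → Prop) (S : Finset Expo), IsCellFamily u v R S →
    (2 ^ m * (t + 2) ^ 4 <
      ((blockSet (fun j => (u j).support ∪ (v j).support) Finset.univ).filter fun n =>
        n ∉ logSupport u v ∧ ∃ l ∈ S, ∃ ξ : Fin 2 → ℝ, ValidWeight u v ξ ∧ IsStrictTop ξ (logSupport u v) l ∧
          wt ξ l < wt ξ n).card) →
    S.card ≤ 2 ^ (a * m) * (t + 2) ^ b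

/-! ## Card 2 `minimal-gauge-normal-form`: gauge FIXING by minimality (the free absence-type hypothesis M2) -/

/-- The partial log-difference of the sub-pair `(I, I')`: `Σ_{j∈I} log(1+u_j) − Σ_{j∈I'} log(1+v_j)`, coefficientwise
(positions outside `I`/`I'` zeroed; `logDiff` is additive over positions). -/
noncomputable def subLogDiff {m : ℕ} (u v : Fin m → MvPolynomial (Fin 2) ℂ) (I I' : Finset (Fin m)) : Expo → ℂ :=
  logDiff (fun j => if j ∈ I then u j else 0) (fun j => if j ∈ I' then v j else 0)

/-- `(I, I')` is a DELETABLE sub-pair for the cell family `S` (order `R`): it carries a nonzero factor, and its partial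
log-difference vanishes at every point on or above the supporting line of every visible point, for some admissible witness of
that point.  Zeroing the positions `I` of `u` and `I'` of `v` then leaves `S` an `R`-cell family (card: lemma «deletion»). -/
def Deletable {m : ℕ} (u v : Fin m → MvPolynomial (Fin 2) ℂ) (R : Expo → Expo → Prop) (S : Finset Expo)
    (I I' : Finset (Fin m)) : Prop :=
  ((∃ j ∈ I, u j ≠ 0) ∨ (∃ j ∈ I', v j ≠ 0)) ∧
  ∀ l ∈ S, ∃ ξ : Fin 2 → ℝ, ValidWeight u v ξ ∧ IsStrictTop ξ (logSupport u v) l ∧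
    (∀ e ∈ tailSupport u v, ∀ e' ∈ tailSupport u v, (R e e' ↔ wt ξ e ≤ wt ξ e')) ∧
    ∀ n, subLogDiff u v I I' n ≠ 0 → wt ξ n < wt ξ l

/-- **M2 (minimal gauge):** no deletable sub-pair.  Every `S`-preserving padding of card `factor-gauge-rigidity` — common deep
(G1), near-common shallow (G2), exact regrouping (G3) — produces an instance VIOLATING `MinimalGauge` (the appended pair of
position sets is deletable), so presence-of-structure residual hypotheses regain content once `MinimalGauge` is added. -/
def MinimalGauge {m : ℕ} (u v : Fin m → MvPolynomial (Fin 2) ℂ) (R : Expo → Expo → Prop) (S : Finset Expo) : Prop :=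
  ∀ I I' : Finset (Fin m), ¬ Deletable u v R S I I'

/-- The per-cell law demanded only of minimal-gauge instances. -/
def CellLawMinimalGauge : Prop :=
  ∃ a b : ℕ, ∀ (m t : ℕ), 2 ≤ t → ∀ (u v : Fin m → MvPolynomial (Fin 2) ℂ),
    (∀ j, coeff 0 (u j) = 0 ∧ (u j).support.card ≤ t) → (∀ j, coeff 0 (v j) = 0 ∧ (v j).support.card ≤ t) →
    ∀ (R : Expo → Expo → Prop) (S : Finset Expo), IsCellFamily u v R S → MinimalGauge u v R S →
    S.card ≤ 2 ^ (a * m) * (t + 2) ^ b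

/-- **FIRST LEMMA of card 2 (K1′, provable now, ≈ 150 lines): gauge fixing is free.**  By well-founded induction on the number of
nonzero factors: zero out a deletable sub-pair; `logDiff` drops by `subLogDiff u v I I'`, which vanishes on and above the chain, so
every `l ∈ S` stays a strict top with the same witness, `ValidWeight` weakens, `tailSupport` shrinks (same `R`), sparsity and
`coeff 0 = 0` persist, `m` and hence the bound are unchanged. -/
def MinimalGaugeReduction : Prop := CellLawMinimalGauge → CellLaw

/-- The RE-TYPED residual proposed to the lead (v22 shape): v21's instance class intersected with the minimal gauge.  Unlike
`ResidualInstanceCellLaw` (≡ `CellLaw` by card 1), this is not reachable by padding: an `S`-preserving enlargement that respects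
`MinimalGauge` must itself carry part of the chain `S` in its own log-support (card 2, «why M2 is not plantable-around»). -/
def ResidualLawV22Shape : Prop :=
  ∃ a b : ℕ, ∀ (m t : ℕ), 2 ≤ t → ∀ (u v : Fin m → MvPolynomial (Fin 2) ℂ),
    (∀ j, coeff 0 (u j) = 0 ∧ (u j).support.card ≤ t) → (∀ j, coeff 0 (v j) = 0 ∧ (v j).support.card ≤ t) →
    NoSmallPermMerge t u v → NoCheapClassCover t u v →
    (∀ ρp ρm : Expo →₀ ℕ, ¬ RankOneCoincidences (fun j => (u j).support ∪ (v j).support) ρp ρm) →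
    ∀ (R : Expo → Expo → Prop) (S : Finset Expo), IsCellFamily u v R S → MinimalGauge u v R S →
    S.card ≤ 2 ^ (a * m) * (t + 2) ^ b

/-- Sanity (kernel): the trivial sub-pair is never deletable. -/
theorem not_deletable_empty {m : ℕ} (u v : Fin m → MvPolynomial (Fin 2) ℂ) (R : Expo → Expo → Prop) (S : Finset Expo) :
    ¬ Deletable u v R S ∅ ∅ := by
  rintro ⟨h | h, -⟩ <;> simp at h

end Summit.ValiantsHypothesis.ValiantsHypothesis.Cruxes.TwoProducts.ValIdea34
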